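import Summits.FinalStateConjecture.FinalStateConjecture.Theorems.LaminatedThreshold.Negative.HeteroclinicCombLemmaFalse

/-!
# Crux `LaminatedThreshold` · card `energy-cones` — its first lemma `ConeCombLemma` is FALSE as typed

Negative support lemma for crux item stmt-FinalStateConjecture-16893 (route LaminatedThreshold), prover seat 0,
2026-08-17. The crux-ideate card `Cruxes/LaminatedThreshold/Ideas/energy-cones.md` (round 1, ideator 1) proposes
to replace the `C¹` hypotheses of the comb line's Stub 1 (`stub_combLemma`, refuted as typed in
`HeteroclinicCombLemmaFalse`) by two-norm CONE CONDITIONS (`Cruxes/LaminatedThreshold/SketchIdeator1.lean`,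
`ConeCombLemma`): points in `E × ℝ`, differences read through `ι : E →L[ℝ] F`, `T` merely continuous on a
ball, the unstable cone `{α ‖ι Δx‖ ≤ |Δt|}` forward-invariant with `|Δt|`-expansion `μ > 1`, `ι`-contraction
`θ < 1` on the stable cone, seeds = `β`-weakly-Lipschitz graphs `t = gᵢ x` through the axis points `(0, σᵢ)`.

`coneCombLemma_false` (this file): **that statement is false as well, by the same planar witness** as
`stub_combLemma_false`. The cone version weakens the hypotheses on `T` and keeps the seed placement, so it
inherits the bug: nothing ties the unstable manifold of `T` to the `t`-axis on which the seeds are anchored.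
Concretely `E = F = ℝ`, `ι = id`, `T (x, t) = (x/2 + (7/2) t², 2t)`, `θ = 3/4`, `μ = 2`, `α = 1`, `β = 0`,
`r₀ = 1/28`: on `ball 0 (1/28)` one has `|Δ(T·)₁| ≤ |Δx|/2 + |Δt|/4` (`combT_fst_sub_le`), whence both cone
clauses (`combT_unstable_cone`, `combT_stable_cone`); the unstable manifold is the parabola `x = t²`; against any
`r₁` take the flat seeds `gᵢ ≡ ±r₁/2` (`0`-Lipschitz) and `ε = σ²/2`: by `iterate_combT` / `fst_iterate_ge`
(seat 1) no small point has a bounded orbit unless `t = 0`, and no small point reaches height exactly `±σ`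
inside the `ε`-ball around `(0, ±σ)`; so the saturated set near `0` lies in `{t = 0}` while `real_lamination`
(AssemblyFrame) puts a point of `Φ ⁻¹' K` on the punctured vertical segment — contradiction.

Consequence for the card (a typing repair, not a verdict on the lever): as for Stub 1, the cone comb lemma
must carry the normalisation that the `t`-axis is `T`-invariant near `0` (adapted coordinates straightening
`W^u`), or measure the seeds' position against `W^u(T)`; in the two-norm setting the first disjunct of the
conclusion should moreover be read in the weak norm. Pure Mathlib analysis; no named facts.
-/

-- every `Summit.FinalStateConjecture.FinalStateConjecture.…` name repeats the summit = sub-problem segment (D-0017 layout)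
set_option linter.dupNamespace false

noncomputable section

open Set Filter Metric Function
open scoped Topology

namespace Summit.FinalStateConjecture.FinalStateConjecture.Theorems.LaminatedThreshold.Negative

/-- **Difference estimate** for the witness map `T (x, t) = (x/2 + (7/2) t², 2t)` on `ball 0 (1/28)`:
`|Δ(T·)₁| ≤ |Δx|/2 + |Δt|/4` (since `|t + t'| < 1/14` there). [folklore] -/
theorem combT_fst_sub_le {p q : ℝ × ℝ} (hp : p ∈ Metric.ball (0 : ℝ × ℝ) (1 / 28))
    (hq : q ∈ Metric.ball (0 : ℝ × ℝ) (1 / 28)) :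
    |(p.1 / 2 + 7 / 2 * p.2 ^ 2) - (q.1 / 2 + 7 / 2 * q.2 ^ 2)| ≤ |p.1 - q.1| / 2 + |p.2 - q.2| / 4 := by
  rw [Metric.mem_ball, dist_zero_right, Prod.norm_def, max_lt_iff, Real.norm_eq_abs, Real.norm_eq_abs] at hp hq
  have hsum : |p.2 + q.2| ≤ 1 / 14 := by
    calc |p.2 + q.2| ≤ |p.2| + |q.2| := abs_add_le _ _
      _ ≤ 1 / 14 := by linarith [hp.2, hq.2]
  have key : (p.1 / 2 + 7 / 2 * p.2 ^ 2) - (q.1 / 2 + 7 / 2 * q.2 ^ 2) =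
      (p.1 - q.1) / 2 + 7 / 2 * ((p.2 + q.2) * (p.2 - q.2)) := by ring
  rw [key]
  calc |(p.1 - q.1) / 2 + 7 / 2 * ((p.2 + q.2) * (p.2 - q.2))|
      ≤ |(p.1 - q.1) / 2| + |7 / 2 * ((p.2 + q.2) * (p.2 - q.2))| := abs_add_le _ _
    _ = |p.1 - q.1| / 2 + 7 / 2 * (|p.2 + q.2| * |p.2 - q.2|) := by
        rw [abs_div, abs_mul, abs_mul, abs_two, abs_of_pos (by norm_num : (0 : ℝ) < 7 / 2)]
    _ ≤ |p.1 - q.1| / 2 + 7 / 2 * ((1 / 14) * |p.2 - q.2|) := by gcongr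
    _ = |p.1 - q.1| / 2 + |p.2 - q.2| / 4 := by ring

/-- **Unstable cone clause** for the witness (`ι = id`, `α = 1`, `μ = 2`, `r₀ = 1/28`): pairs with
`|Δx| ≤ |Δt|` are mapped to such pairs and `|Δt|` is doubled. [folklore] -/
theorem combT_unstable_cone {p q : ℝ × ℝ} (hp : p ∈ Metric.ball (0 : ℝ × ℝ) (1 / 28))
    (hq : q ∈ Metric.ball (0 : ℝ × ℝ) (1 / 28)) (hcone : 1 * |p.1 - q.1| ≤ |p.2 - q.2|) :
    1 * |(p.1 / 2 + 7 / 2 * p.2 ^ 2) - (q.1 / 2 + 7 / 2 * q.2 ^ 2)| ≤ |2 * p.2 - 2 * q.2| ∧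
      2 * |p.2 - q.2| ≤ |2 * p.2 - 2 * q.2| := by
  have h2 : |2 * p.2 - 2 * q.2| = 2 * |p.2 - q.2| := by
    rw [← mul_sub, abs_mul, abs_two]
  rw [h2, one_mul]
  rw [one_mul] at hcone
  refine ⟨?_, le_rfl⟩
  have h := combT_fst_sub_le hp hq
  linarith [abs_nonneg (p.2 - q.2)]

/-- **Stable cone clause** for the witness (`θ = 3/4`): on pairs with `|Δt| ≤ |Δx|` the first component is
contracted by `3/4`. [folklore] -/
theorem combT_stable_cone {p q : ℝ × ℝ} (hp : p ∈ Metric.ball (0 : ℝ × ℝ) (1 / 28))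
    (hq : q ∈ Metric.ball (0 : ℝ × ℝ) (1 / 28)) (hcone : |p.2 - q.2| ≤ 1 * |p.1 - q.1|) :
    |(p.1 / 2 + 7 / 2 * p.2 ^ 2) - (q.1 / 2 + 7 / 2 * q.2 ^ 2)| ≤ 3 / 4 * |p.1 - q.1| := by
  rw [one_mul] at hcone
  have h := combT_fst_sub_le hp hq
  linarith

/-- **`ConeCombLemma` of card `energy-cones` is false** (the statement of
`Cruxes/LaminatedThreshold/SketchIdeator1.lean`, verbatim, negated). Witness: `E = F = ℝ`, `ι = id`,
`T (x, t) = (x/2 + (7/2) t², 2t)`, `θ = 3/4`, `μ = 2`, `α = 1`, `β = 0`, `r₀ = 1/28`; against any `r₁ > 0` the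
flat seeds `gᵢ ≡ ±r₁/2` and `ε = σ²/2`, `σ = r₁/2`: inside the box of size `min 1 (σ²/4)` the saturated set lies in
`{t = 0}` (`fst_iterate_ge`, unbounded heights `2ⁿ t`), whereas `real_lamination` puts a point of `Φ ⁻¹' K` on
the punctured vertical segment through `0`. [folklore] -/
theorem coneCombLemma_false : ¬ (∀ (E F : Type) [NormedAddCommGroup E] [NormedSpace ℝ E] [CompleteSpace E]
    [NormedAddCommGroup F] [NormedSpace ℝ F] (ι : E →L[ℝ] F)
    (T : E × ℝ → E × ℝ) (θ μ α β r₀ : ℝ),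
    T 0 = 0 → 0 < r₀ → 0 ≤ θ → θ < 1 → 1 < μ → 0 ≤ β → β < α →
    ContinuousOn T (Metric.ball 0 r₀) →
    (∀ p ∈ Metric.ball (0 : E × ℝ) r₀, ∀ q ∈ Metric.ball (0 : E × ℝ) r₀,
        α * ‖ι (p.1 - q.1)‖ ≤ |p.2 - q.2| →
          α * ‖ι ((T p).1 - (T q).1)‖ ≤ |(T p).2 - (T q).2| ∧
            μ * |p.2 - q.2| ≤ |(T p).2 - (T q).2|) →
    (∀ p ∈ Metric.ball (0 : E × ℝ) r₀, ∀ q ∈ Metric.ball (0 : E × ℝ) r₀,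
        |p.2 - q.2| ≤ α * ‖ι (p.1 - q.1)‖ →
          ‖ι ((T p).1 - (T q).1)‖ ≤ θ * ‖ι (p.1 - q.1)‖) →
    ∃ r₁ : ℝ, 0 < r₁ ∧ ∀ (σ₁ σ₂ : ℝ) (g₁ g₂ : E → ℝ),
      0 < σ₁ ∧ σ₁ < r₁ ∧ -r₁ < σ₂ ∧ σ₂ < 0 ∧ g₁ 0 = σ₁ ∧ g₂ 0 = σ₂ ∧
      (∃ r' : ℝ, 0 < r' ∧ ∀ x ∈ Metric.ball (0 : E) r', ∀ y ∈ Metric.ball (0 : E) r',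
          |g₁ x - g₁ y| ≤ β * ‖ι (x - y)‖ ∧ |g₂ x - g₂ y| ≤ β * ‖ι (x - y)‖) →
      ∀ ε : ℝ, 0 < ε → ∃ ρ : ℝ, 0 < ρ ∧ ∃ (Φ : E × ℝ → ℝ) (K : Set ℝ),
        Φ 0 = 0 ∧ (0 : ℝ) ∈ K ∧
        (∀ η : ℝ, 0 < η → (K ∩ Set.Ioo (0 - η) 0).Nonempty ∧ (K ∩ Set.Ioo 0 (0 + η)).Nonempty) ∧
        ContinuousOn Φ (Metric.ball 0 ρ) ∧
        ∀ p ∈ Metric.ball (0 : E × ℝ) ρ, Φ p ∈ K →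
          ((∀ n : ℕ, T^[n] p ∈ Metric.ball (0 : E × ℝ) ε) ∨
            (∃ n : ℕ, T^[n] p ∈ Metric.ball ((0 : E), σ₁) ε ∧ (T^[n] p).2 = g₁ (T^[n] p).1) ∨
            (∃ n : ℕ, T^[n] p ∈ Metric.ball ((0 : E), σ₂) ε ∧ (T^[n] p).2 = g₂ (T^[n] p).1))) := by
  intro h
  have hT := h ℝ ℝ (ContinuousLinearMap.id ℝ ℝ) (fun p : ℝ × ℝ ↦ (p.1 / 2 + 7 / 2 * p.2 ^ 2, 2 * p.2))
    (3 / 4) 2 1 0 (1 / 28) combT_zero (by norm_num) (by norm_num) (by norm_num) one_lt_two le_rfl one_pos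
    (contDiff_combT.continuous.continuousOn) ?_ ?_
  rotate_left
  · intro p hp q hq hcone
    simp only [ContinuousLinearMap.coe_id', id_eq, Real.norm_eq_abs] at hcone ⊢
    exact combT_unstable_cone hp hq hcone
  · intro p hp q hq hcone
    simp only [ContinuousLinearMap.coe_id', id_eq, Real.norm_eq_abs] at hcone ⊢
    exact combT_stable_cone hp hq hcone
  obtain ⟨r₁, hr₁, hcomb⟩ := hT
  -- the flat seeds at heights `±σ`, `σ = r₁/2`
  set σ : ℝ := r₁ / 2 with hσ
  have hσpos : 0 < σ := by positivity
  have hseed := hcomb σ (-σ) (fun _ ↦ σ) (fun _ ↦ -σ)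
    ⟨hσpos, by rw [hσ]; linarith, by rw [hσ]; linarith, by linarith, rfl, rfl,
      ⟨1, one_pos, fun x _ y _ ↦ ⟨by simp, by simp⟩⟩⟩ (σ ^ 2 / 2) (by positivity)
  obtain ⟨ρ, hρ, Φ, K, hΦ0, hK0, hacc, hcont, hsat⟩ := hseed
  -- the small box
  set ρ₀ : ℝ := min 1 (σ ^ 2 / 4) with hρ₀
  have hρ₀pos : 0 < ρ₀ := by positivity
  have hρ₀1 : ρ₀ ≤ 1 := min_le_left _ _
  have hρ₀σ : ρ₀ ≤ σ ^ 2 / 4 := min_le_right _ _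
  set ρ' : ℝ := min ρ ρ₀ with hρ'
  have hρ'pos : 0 < ρ' := lt_min hρ hρ₀pos
  have hρ'ρ : ρ' ≤ ρ := min_le_left _ _
  have hρ'ρ₀ : ρ' ≤ ρ₀ := min_le_right _ _
  -- STEP 1: inside the box, a saturated point lies on the stable line `t = 0`
  have hsat0 : ∀ x t : ℝ, |x| < ρ' → |t| < ρ' → ((x, t) : ℝ × ℝ) ∈ Metric.ball (0 : ℝ × ℝ) ρ →
      Φ (x, t) ∈ K → t = 0 := by
    intro x t hx ht hball hK
    by_contra htne
    have hx₀ : |x| < ρ₀ := hx.trans_le hρ'ρ₀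
    have ht₀ : |t| < ρ₀ := ht.trans_le hρ'ρ₀
    rcases hsat (x, t) hball hK with h0 | ⟨n, hn, hG⟩ | ⟨n, hn, hG⟩
    · -- bounded orbit is impossible: heights `2ⁿ t` are unbounded
      have htpos : 0 < |t| := abs_pos.2 htne
      obtain ⟨n, hn⟩ := pow_unbounded_of_one_lt (σ ^ 2 / 2 / |t|) (one_lt_two (α := ℝ))
      have hge : σ ^ 2 / 2 < |2 ^ n * t| := by
        rw [abs_mul, abs_of_pos (by positivity : (0 : ℝ) < 2 ^ n)]
        rwa [div_lt_iff₀ htpos] at hn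
      have hmem := h0 n
      rw [Metric.mem_ball, dist_zero_right, iterate_combT] at hmem
      have hsnd := norm_snd_le (((2 ^ n * t) ^ 2 + (x - t ^ 2) / 2 ^ n, 2 ^ n * t) : ℝ × ℝ)
      simp only [Real.norm_eq_abs] at hsnd
      linarith
    · -- seed 1 is hit exactly: `2ⁿ t = σ`, then the point is far from the axis
      rw [iterate_combT] at hG
      simp only at hG
      have hsq : (2 ^ n * t) ^ 2 = σ ^ 2 := by rw [hG]
      have hfst := fst_iterate_ge hx₀ ht₀ hρ₀1 hρ₀σ hsq
      rw [Metric.mem_ball, Prod.dist_eq, max_lt_iff] at hn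
      have h1 := hn.1
      rw [Real.dist_eq, sub_zero] at h1
      linarith [(abs_lt.1 h1).2]
    · -- seed 2 is hit exactly: `2ⁿ t = -σ`
      rw [iterate_combT] at hG
      simp only at hG
      have hsq : (2 ^ n * t) ^ 2 = σ ^ 2 := by rw [hG]; ring
      have hfst := fst_iterate_ge hx₀ ht₀ hρ₀1 hρ₀σ hsq
      rw [Metric.mem_ball, Prod.dist_eq, max_lt_iff] at hn
      have h1 := hn.1
      rw [Real.dist_eq, sub_zero] at h1
      linarith [(abs_lt.1 h1).2]
  -- STEP 2: along the vertical segment through `0`, `Φ` takes a value in `K` at a positive height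
  set f : ℝ → ℝ := fun s ↦ Φ ((0 : ℝ), s) with hf
  have hf0 : f 0 = 0 := by
    have h00 : ((0 : ℝ), (0 : ℝ)) = (0 : ℝ × ℝ) := rfl
    simp only [hf]
    rw [h00]
    exact hΦ0
  have hseg : ∀ s ∈ Set.Ico (0 : ℝ) ρ', ((0 : ℝ), s) ∈ Metric.ball (0 : ℝ × ℝ) ρ := by
    intro s hs
    rw [Metric.mem_ball, dist_zero_right, Prod.norm_def, norm_zero, Real.norm_eq_abs,
      abs_of_nonneg hs.1, max_eq_right hs.1]
    exact hs.2.trans_le hρ'ρ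
  have hfcont : ContinuousOn f (Set.Ico 0 ρ') := by
    have hγ : Continuous fun s : ℝ ↦ ((0 : ℝ), s) := continuous_const.prodMk continuous_id
    exact hcont.comp hγ.continuousOn fun s hs ↦ hseg s hs
  have hacc' : ∀ η : ℝ, 0 < η →
      (K ∩ Set.Ioo (f 0 - η) (f 0)).Nonempty ∧ (K ∩ Set.Ioo (f 0) (f 0 + η)).Nonempty := by
    rw [hf0]; exact hacc
  have hK0' : f 0 ∈ K := by rw [hf0]; exact hK0
  obtain ⟨s, hs, hsK⟩ := real_lamination hρ'pos hK0' hacc' hfcont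
  -- contradiction: `(0, s)` is saturated with `s ≠ 0`
  have hs0 : s = 0 := hsat0 0 s (by rw [abs_zero]; exact hρ'pos)
    (by rw [abs_of_pos hs.1]; exact hs.2) (hseg s ⟨hs.1.le, hs.2⟩) hsK
  exact absurd hs0 (ne_of_gt hs.1)

end Summit.FinalStateConjecture.FinalStateConjecture.Theorems.LaminatedThreshold.Negative

end
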